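import Summits.QuantumFields.YangMills.Theorems.UnitScaleTiltProp8IterTangent
import HarnessLib

/-!
# Route `UnitScaleTilt`, crux K1 «MinimiserStabilityRegPr» (stmt-QuantumFields-19200), stub `stub_prop8` (V2) — sub-lemma V2-EL, part 7f:
# **THE k-FOLD SELECTIVE EXACT CORRECTOR** of the (0.4)-descent (`exists_iter_eq_of_near`)

Cell `ym3-torus` ∕ fleet seat `ym-ust-19200-p2` g4.  The k-fold companion of the one-step exact corrector (`BlockAvgCorrector.exists_avgFun_eq_of_near`, p448916,
and its selective form, part 7a): if all iterated averages `Ū^{(i)}`, `i < k`, of an `SU(2)` field `U` are `t`-small and a level-`k` field `W` is `η`-close to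
`Ū^{(k)}` bond by bond, with `stokesConst·t + (2|I|)^k·η ≤ |I|⁻¹/16`, then `W = Ū′^{(k)}` EXACTLY for a field `U′` within `(2|I|)^k·η` of `U` bond by bond which
agrees with `U` outside the bottom set `T₀` of any tower of exceptional bond sets closed downwards under the central-bond maps, provided `W` already agrees
with `Ū^{(k)}` off `T_k` (minimal tower: `U′ = U` off the iterated central bonds `β^k(T_k)`).  With parts 7c–7d this is the qualitative chart «C_k» of the
k-fold fibre at a fixed lattice (existence of the graph; tangent curves; Euler–Lagrange); the modulus `(2|I|)^k` is NOT uniform in `k` — the k-uniform chart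
([Balaban1985Variational] (47)–(48), [Balaban1985Averaging] Props 3–4) remains open.  PROOF: induction peeling the top averaging, one-step selective
corrector at level `k` then the induction hypothesis with tolerance `2|I|η`.  Sorry-free, no definition. [folklore]
References: T. Bałaban, CMP 102 (1985) 277–309 [Balaban1985Variational] ((47)–(48) p.287); CMP 109 (1987) 249–301 [Balaban1987RG1] ((0.4), (0.11) p.253).
-/

noncomputable section

open scoped BigOperators Matrix.Norms.L2Operator Matrix Topology
open Filter Function NormedSpace

namespace Summit.QuantumFields.YangMills.Theorems.Prop8Criticality

open Literature.MathematicalPhysics.QuantumFieldTheory.Balaban1983to89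
open T4Continuum AveragingRT BlockAveraging BlockAveragingHaarAC BlockAveragingEMLHaarAC ExpMeanLog
open Summit.QuantumFields.YangMills.Theorems.BlockAvgCorrector (stokesConst stokesConst_nonneg emlWeight_pos emlWeight_le_one)

variable {P : Params}

/-- **THE k-FOLD SELECTIVE EXACT CORRECTOR.**  Let `t ≥ 0`.  For every level `n ≤ m + K`, every `SU(2)` field `U` on the finest lattice with `t`-small
iterated (0.4)-averages `Ū^{(i)}`, `i < n`, every tower `T_i ⊆ {level-i bonds}` closed downwards under the central-bond maps below level `n`, and every
level-`n` field `W` with `‖W(c) − Ū^{(n)}(c)‖ ≤ η` for all `c`, `W(c) = Ū^{(n)}(c)` for `c ∉ T_n`, and `stokesConst·t + (2∕|I|⁻¹)^n·η ≤ |I|⁻¹/16`: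
there is `U′` with `Ū′^{(n)} = W` exactly, `U′(b) = U(b)` for `b ∉ T₀`, and `‖U′(b) − U(b)‖ ≤ (2∕|I|⁻¹)^n·η` for all `b`.
[cite: Balaban1987RG1, (0.4) p.253; Balaban1985Variational, (47) p.287] -/
theorem exists_iter_eq_of_near {t : ℝ} (ht : 0 ≤ t) :
    ∀ n : ℕ, n ≤ P.m + P.K →
    ∀ U : GaugeField P 0 (Matrix.specialUnitaryGroup (Fin 2) ℂ),
      (∀ i, i < n → PlaqSmall t (Averaging.iter (fun i => blockAvg (P := P) (j := i) (expMeanLogSU (n := Fin 2))) i U)) →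
    ∀ T : (i : ℕ) → Set (PBond P i),
      (∀ i, i < n → ∀ c : PBond P (i + 1), c ∈ T (i + 1) → centralBond c ∈ T i) →
    ∀ (η : ℝ), 0 ≤ η → stokesConst P * t + (2 / emlWeight P) ^ n * η ≤ emlWeight P / 16 →
    ∀ W : GaugeField P n (Matrix.specialUnitaryGroup (Fin 2) ℂ),
      (∀ c : PBond P n, ‖((W c : Matrix.specialUnitaryGroup (Fin 2) ℂ) : Matrix (Fin 2) (Fin 2) ℂ) -
        ((Averaging.iter (fun i => blockAvg (P := P) (j := i) (expMeanLogSU (n := Fin 2))) n U c : Matrix.specialUnitaryGroup (Fin 2) ℂ) :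
          Matrix (Fin 2) (Fin 2) ℂ)‖ ≤ η) →
      (∀ c : PBond P n, c ∉ T n → W c = Averaging.iter (fun i => blockAvg (P := P) (j := i) (expMeanLogSU (n := Fin 2))) n U c) →
    ∃ U' : GaugeField P 0 (Matrix.specialUnitaryGroup (Fin 2) ℂ),
      Averaging.iter (fun i => blockAvg (P := P) (j := i) (expMeanLogSU (n := Fin 2))) n U' = W ∧
      (∀ b : PBond P 0, b ∉ T 0 → U' b = U b) ∧
      ∀ b : PBond P 0, ‖((U' b : Matrix.specialUnitaryGroup (Fin 2) ℂ) : Matrix (Fin 2) (Fin 2) ℂ) - (U b : Matrix (Fin 2) (Fin 2) ℂ)‖ ≤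
        (2 / emlWeight P) ^ n * η := by
  intro n
  induction n with
  | zero =>
    intro _ U _ T _ η _ _ W hW hWT
    refine ⟨W, iter_zero_apply _ _, fun b hb => ?_, fun b => ?_⟩
    · rw [hWT b hb, iter_zero_apply]
    · have h := hW b
      rw [iter_zero_apply] at h
      simpa using h
  | succ n ih =>
    intro hn U hsm T hT η hη hsmall W hW hWT
    have hκ : 0 < emlWeight P := emlWeight_pos P
    have hκ1 : emlWeight P ≤ 1 := emlWeight_le_one P
    have hst : 0 ≤ stokesConst P * t := mul_nonneg (stokesConst_nonneg P) ht
    have hq1 : 1 ≤ 2 / emlWeight P := by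
      rw [le_div_iff₀ hκ]; linarith
    have hqn : 1 ≤ (2 / emlWeight P) ^ n := one_le_pow₀ hq1
    -- the level-`n` ambient field and the one-step selective corrector at the top
    set Λ : GaugeField P n (Matrix.specialUnitaryGroup (Fin 2) ℂ) :=
      Averaging.iter (fun i => blockAvg (P := P) (j := i) (expMeanLogSU (n := Fin 2))) n U with hΛ
    have hΛsmall : PlaqSmall t Λ := hsm n (Nat.lt_succ_self n)
    have hpow : (2 / emlWeight P) ^ (n + 1) * η = (2 / emlWeight P) ^ n * (2 * η / emlWeight P) := by
      rw [pow_succ]; ring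
    have h1 : 2 * η / emlWeight P ≤ (2 / emlWeight P) ^ (n + 1) * η := by
      rw [hpow]
      have : 0 ≤ 2 * η / emlWeight P := div_nonneg (by linarith) hκ.le
      nlinarith
    have hsmall₁ : stokesConst P * t + 2 * η / emlWeight P ≤ emlWeight P / 16 := by linarith
    have hguard : stokesConst P * t + 2 * η / emlWeight P < (expMeanLogSU (n := Fin 2)).δ := by
      rw [expMeanLogSU_two_δ]; linarith
    have hWΛ : ∀ c, ‖((W c : Matrix.specialUnitaryGroup (Fin 2) ℂ) : Matrix (Fin 2) (Fin 2) ℂ) -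
        ((avgFun (expMeanLogSU (n := Fin 2)) Λ c : Matrix.specialUnitaryGroup (Fin 2) ℂ) : Matrix (Fin 2) (Fin 2) ℂ)‖ ≤ η := by
      intro c
      have := hW c
      rwa [iter_succ_eq_avgFun] at this
    obtain ⟨μ, hμW, hμoff, hμsel, hμdist⟩ :=
      exists_avgFun_eq_of_near_selective (n := Fin 2) hn ht hη hsmall₁ hguard Λ hΛsmall W hWΛ
    -- the new target agrees with `Λ` off `T n`
    have hμT : ∀ c : PBond P n, c ∉ T n → μ c = Λ c := by
      intro c hc
      by_cases hcen : ∃ c' : PBond P (n + 1), centralBond c' = c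
      · obtain ⟨c', rfl⟩ := hcen
        have hc' : c' ∉ T (n + 1) := fun h => hc (hT n (Nat.lt_succ_self n) c' h)
        refine hμsel c' ?_
        rw [hWT c' hc', iter_succ_eq_avgFun]
      · push Not at hcen
        exact hμoff c fun c' h => hcen c' h
    -- lift the new target all the way down (induction hypothesis with tolerance `2η|I|`)
    have hsmall' : stokesConst P * t + (2 / emlWeight P) ^ n * (2 * η / emlWeight P) ≤ emlWeight P / 16 := by rwa [← hpow]
    obtain ⟨U', hU'iter, hU'off, hU'dist⟩ := ih (Nat.le_of_succ_le hn) U (fun i hi => hsm i (Nat.lt_succ_of_lt hi)) T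
      (fun i hi => hT i (Nat.lt_succ_of_lt hi)) (2 * η / emlWeight P) (div_nonneg (by linarith) hκ.le) hsmall' μ hμdist hμT
    refine ⟨U', ?_, hU'off, fun b => ?_⟩
    · rw [iter_succ_eq_avgFun, hU'iter, hμW]
    · rw [hpow]; exact hU'dist b

end Summit.QuantumFields.YangMills.Theorems.Prop8Criticality

end
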